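import Literature.Dynamics.Hyperbolic.SequenceShadowingUniqueness

/-!
# Shadowing for a sequence of maps of a Banach space, VI: skew (non-invariant unstable) linear parts

Pilyugin's Theorem 1.3.5 (S. Yu. Pilyugin, *Shadowing in Dynamical Systems*, LNM 1706 (1999), §1.3.4,
pp. 44–46) in the setting of `SequenceShadowing*`: the linear parts of `φ_k = A_k + w_{k+1}` are
`A_k = B_k + C_k` with `(B, P, B⁻)` a `(λ, N)`-hyperbolic sequence (`IsHyperbolicSequence`) and SKEW
COUPLINGS `C_k` with `C_k S_k = 0`, `C_k E ⊆ S_{k+1}`, `‖C_k‖ ≤ M` (`IsSkewCoupling`, Pilyugin's condition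
(b)) — the shape of the linearisation of a `C¹` map along a PSEUDO-orbit of a hyperbolic set whose
unstable spaces are not invariant (Steinlein–Walther sets; the rigorous Chow–Lin–Palmer reduction).
Contents: `skewGreen` (Pilyugin's `𝒢 z = y + u¹ + u²`, realised as the landed Green operator `green`
applied to the modified forcing `z_k + C_{k-1}(𝒢⁰z)_{k-1}`), its bound `N₂ = N₁(1 + M N₁)`
(`norm_skewGreen_le`; Pilyugin's constant is `N(1+N²λ)/(1-λ)²`), the recursion `BC_skewGreen`,
additivity `skewGreen_sub`; THEOREM 1.3.5 `exists_shadow_skew` (`‖v_k‖ ≤ Ld`, `L = N₂/(1-κN₂)`,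
`d ≤ Δ/L`); and, under the expansion condition (b') on `B`, `eq_zero_of_bounded_skew` and the
UNIQUENESS `shadow_unique_skew` of trajectories in the `Δ`-ball (Pilyugin proves only existence; the
uniqueness is the dichotomy argument of `shadow_unique`).  Everything is proved, following
`SequenceShadowingExistence` / `SequenceShadowingUniqueness` with `green ↦ skewGreen`, `N₁ ↦ N₂`.

## References

* S. Yu. Pilyugin, *Shadowing in Dynamical Systems*, LNM 1706 (1999), §1.3.4, Theorem 1.3.5. [Pilyugin1999]
-/
noncomputable section

open Filter Set Function
open scoped Topology NNReal BoundedContinuousFunction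

namespace Literature.Dynamics.Hyperbolic

variable {E : Type*} [NormedAddCommGroup E] [NormedSpace ℝ E]

/-- **Skew couplings** `C k : E →L[ℝ] E` relative to the projectors `P k` (condition (b) of Pilyugin's
Theorem 1.3.5 together with the norm bound of (a1)): `‖C_k‖ ≤ M`, `C_k` vanishes on the stable part
`S_k = P_k E` and takes values in `S_{k+1}`. [cite: Pilyugin1999, Thm 1.3.5 conditions (a1), (b)] -/
structure IsSkewCoupling (P C : ℤ → E →L[ℝ] E) (M : ℝ) : Prop where
  /-- `0 ≤ M`. -/
  M_nonneg : 0 ≤ M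
  /-- `‖C_k‖ ≤ M`. -/
  norm_le : ∀ k : ℤ, ‖C k‖ ≤ M
  /-- `C_k S_k = 0`. -/
  apply_stable : ∀ (k : ℤ), ∀ v ∈ stableSpace P k, C k v = 0
  /-- `C_k E ⊆ S_{k+1}`. -/
  mem_stable : ∀ (k : ℤ) (v : E), C k v ∈ stableSpace P (k + 1)

/-- The modified forcing `z̃_k = z_k + C_{k-1} (𝒢⁰ z)_{k-1}` (`𝒢⁰ = green`, the Green operator of `B`). [folklore] -/
def skewForcing (B P Binv C : ℤ → E →L[ℝ] E) (z : ℤ → E) (k : ℤ) : E :=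
  z k + C (k - 1) (green B P Binv z (k - 1))

/-- **The Green operator of the skew recursion** `u_{n+1} = (B_n + C_n) u_n + z_{n+1}`:
`𝒢 z = 𝒢⁰ z̃` with the modified forcing `z̃ = skewForcing z` (equivalently Pilyugin's `y + u¹ + u²`).
[cite: Pilyugin1999, Thm 1.3.5 (proof, operator 𝒢)] -/
def skewGreen (B P Binv C : ℤ → E →L[ℝ] E) (z : ℤ → E) (n : ℤ) : E :=
  green B P Binv (skewForcing B P Binv C z) n

/-- The norm bound `N₂ = N₁ (1 + M N₁)` of the skew Green operator. [folklore] -/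
def skewGreenBound (lam N M : ℝ) : ℝ := greenBound lam N * (1 + M * greenBound lam N)

/-- The shadowing constant `L = N₂ / (1 - κ N₂)` of Theorem 1.3.5. [cite: Pilyugin1999, Thm 1.3.5] -/
def skewShadowConst (lam N M κ : ℝ) : ℝ := skewGreenBound lam N M / (1 - κ * skewGreenBound lam N M)

namespace IsHyperbolicSequence

variable {B P Binv C : ℤ → E →L[ℝ] E} {lam N M : ℝ}

/-- `(1 - P_k) c = 0` for `c ∈ S_k`. [folklore] -/
theorem one_sub_P_apply_of_mem_stable (h : IsHyperbolicSequence B P Binv lam N) {k : ℤ} {c : E}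
    (hc : c ∈ stableSpace P k) : ((1 : E →L[ℝ] E) - P k) c = 0 := by
  rw [show ((1 : E →L[ℝ] E) - P k) c = (1 : E →L[ℝ] E) c - P k c from rfl, one_apply_eq_self,
    h.P_apply_of_mem_stable hc, sub_self]

/-- Bound on the modified forcing: `‖z̃_k‖ ≤ (1 + M N₁) C₀` when `‖z_k‖ ≤ C₀`. [folklore] -/
theorem norm_skewForcing_le (h : IsHyperbolicSequence B P Binv lam N) (hC : IsSkewCoupling P C M)
    {z : ℤ → E} {C₀ : ℝ} (hz : ∀ k, ‖z k‖ ≤ C₀) (k : ℤ) :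
    ‖skewForcing B P Binv C z k‖ ≤ (1 + M * greenBound lam N) * C₀ := by
  unfold skewForcing
  have h1 := h.norm_green_le hz (k - 1)
  have h2 : ‖C (k - 1) (green B P Binv z (k - 1))‖ ≤ M * (greenBound lam N * C₀) :=
    (ContinuousLinearMap.le_opNorm _ _).trans
      (mul_le_mul (hC.norm_le _) h1 (norm_nonneg _) hC.M_nonneg)
  calc ‖z k + C (k - 1) (green B P Binv z (k - 1))‖
      ≤ ‖z k‖ + ‖C (k - 1) (green B P Binv z (k - 1))‖ := norm_add_le _ _
    _ ≤ C₀ + M * (greenBound lam N * C₀) := add_le_add (hz k) h2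
    _ = (1 + M * greenBound lam N) * C₀ := by ring

/-- `N₂ ≥ N₁ > 0`. [folklore] -/
theorem skewGreenBound_pos (h : IsHyperbolicSequence B P Binv lam N) (hM : 0 ≤ M) :
    0 < skewGreenBound lam N M := by
  unfold skewGreenBound
  have := h.greenBound_pos
  positivity

/-- **Norm bound of the skew Green operator**: `‖(𝒢 z)_n‖ ≤ N₂ C₀` if `‖z_k‖ ≤ C₀`.
[cite: Pilyugin1999, Thm 1.3.5 (proof, ‖𝒢‖ ≤ N₂)] -/
theorem norm_skewGreen_le (h : IsHyperbolicSequence B P Binv lam N) (hC : IsSkewCoupling P C M)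
    {z : ℤ → E} {C₀ : ℝ} (hz : ∀ k, ‖z k‖ ≤ C₀) (n : ℤ) :
    ‖skewGreen B P Binv C z n‖ ≤ skewGreenBound lam N M * C₀ := by
  unfold skewGreen skewGreenBound
  have := h.norm_green_le (h.norm_skewForcing_le hC hz) n
  calc ‖green B P Binv (skewForcing B P Binv C z) n‖ ≤ greenBound lam N * ((1 + M * greenBound lam N) * C₀) := this
    _ = greenBound lam N * (1 + M * greenBound lam N) * C₀ := by ring

variable [CompleteSpace E]

/-- The Green operator of `B` maps STABLE-VALUED forcings to stable values: if `c_k ∈ S_k` for all `k`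
(and `c` is bounded) then `(𝒢⁰ c)_n ∈ S_n` — its unstable series vanishes termwise. [folklore] -/
theorem green_mem_stable (h : IsHyperbolicSequence B P Binv lam N) {c : ℤ → E} {C₀ : ℝ}
    (hcb : ∀ k, ‖c k‖ ≤ C₀) (hc : ∀ k, c k ∈ stableSpace P k) (n : ℤ) :
    green B P Binv c n ∈ stableSpace P n := by
  have hu : ∀ m : ℕ, unstableTerm P Binv c n m = 0 := fun m => by
    unfold unstableTerm
    rw [h.one_sub_P_apply_of_mem_stable (hc _), map_zero]
  have hs : P n (∑' m : ℕ, stableTerm B P c n m) = ∑' m : ℕ, stableTerm B P c n m := by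
    rw [ContinuousLinearMap.map_tsum _ (h.summable_stableTerm hcb n)]
    exact tsum_congr fun m => h.P_apply_of_mem_stable (h.stableTerm_mem c n m)
  unfold green
  rw [tsum_congr hu, tsum_zero, sub_zero]
  refine mem_stableSpace.2 ⟨P n (c n) + ∑' m : ℕ, stableTerm B P c n m, ?_⟩
  rw [map_add, h.proj_idem, hs]

/-- **The skew Green operator solves the skew recursion**:
`(B_n + C_n) (𝒢 z)_n = (𝒢 z)_{n+1} - z_{n+1}` for bounded `z`. [cite: Pilyugin1999, Thm 1.3.5 (proof)] -/
theorem BC_skewGreen (h : IsHyperbolicSequence B P Binv lam N) (hC : IsSkewCoupling P C M)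
    {z : ℤ → E} {C₀ : ℝ} (hz : ∀ k, ‖z k‖ ≤ C₀) (n : ℤ) :
    (B n + C n) (skewGreen B P Binv C z n) = skewGreen B P Binv C z (n + 1) - z (n + 1) := by
  have hzt := h.norm_skewForcing_le hC hz
  -- the stable-valued correction `c = z̃ - z`
  set c : ℤ → E := fun k => C (k - 1) (green B P Binv z (k - 1)) with hcdef
  have hc_mem : ∀ k, c k ∈ stableSpace P k := fun k => by
    have := hC.mem_stable (k - 1) (green B P Binv z (k - 1))
    rwa [sub_add_cancel] at this
  have hcb : ∀ k, ‖c k‖ ≤ M * (greenBound lam N * C₀) := fun k =>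
    (ContinuousLinearMap.le_opNorm _ _).trans
      (mul_le_mul (hC.norm_le _) (h.norm_green_le hz (k - 1)) (norm_nonneg _) hC.M_nonneg)
  have hsplit : green B P Binv (skewForcing B P Binv C z) n = green B P Binv z n + green B P Binv c n := by
    have e : (fun k => skewForcing B P Binv C z k - z k) = c := by
      funext k; simp only [skewForcing, hcdef, add_sub_cancel_left]
    have := h.green_sub hzt hz n
    rw [e] at this
    rw [this, add_sub_cancel]
  have hCkill : C n (green B P Binv c n) = 0 := hC.apply_stable n _ (h.green_mem_stable hcb hc_mem n)
  unfold skewGreen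
  rw [_root_.add_apply, h.A_green hzt n, hsplit, map_add, hCkill, add_zero]
  have e2 : skewForcing B P Binv C z (n + 1) = z (n + 1) + C n (green B P Binv z n) := by
    simp only [skewForcing, add_sub_cancel_right]
  rw [e2]
  abel

/-- **The skew Green operator is additive** on bounded sequences. [folklore] -/
theorem skewGreen_sub (h : IsHyperbolicSequence B P Binv lam N) (hC : IsSkewCoupling P C M)
    {z z' : ℤ → E} {C₀ C₀' : ℝ} (hz : ∀ k, ‖z k‖ ≤ C₀) (hz' : ∀ k, ‖z' k‖ ≤ C₀') (n : ℤ) :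
    skewGreen B P Binv C (fun k => z k - z' k) n = skewGreen B P Binv C z n - skewGreen B P Binv C z' n := by
  unfold skewGreen
  rw [← h.green_sub (h.norm_skewForcing_le hC hz) (h.norm_skewForcing_le hC hz') n]
  congr 1
  funext k
  simp only [skewForcing]
  rw [h.green_sub hz hz' (k - 1), map_sub]
  abel

omit [CompleteSpace E] in
/-- `N₂ ≥ 1`. [folklore] -/
theorem one_le_skewGreenBound (h : IsHyperbolicSequence B P Binv lam N) (hM : 0 ≤ M) :
    1 ≤ skewGreenBound lam N M := by
  unfold skewGreenBound
  have h1 := h.one_le_greenBound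
  have h2 : 0 ≤ M * greenBound lam N := mul_nonneg hM h.greenBound_pos.le
  nlinarith

/-- **Pilyugin's Theorem 1.3.5 (shadowing for a sequence of maps with skew linear parts, `k ∈ ℤ`).**
Let `(B, P, B⁻)` be a `(λ, N)`-hyperbolic sequence on the Banach space `E`, `C` skew couplings with
`‖C_k‖ ≤ M`, and `φ k : E → E` maps whose nonlinear parts `φ_k - (B_k + C_k)` are `κ`-Lipschitz on the
ball `‖v‖ ≤ Δ`, with `κ N₂ < 1`, `N₂ = N₁(1 + M N₁)`.  Put `L = N₂/(1-κN₂)`.  If `‖φ_k(0)‖ ≤ d ≤ Δ/L` for all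
`k`, there is a sequence `v_k` with `φ_k(v_k) = v_{k+1}` and `‖v_k‖ ≤ L d`.  (Banach's fixed point theorem
for `v ↦ 𝒢 w̄(v)` on the `Ld`-ball of `ℓ_∞(ℤ; E)`.) [cite: Pilyugin1999, Thm 1.3.5] -/
theorem exists_shadow_skew (h : IsHyperbolicSequence B P Binv lam N) (hC : IsSkewCoupling P C M)
    {φ : ℤ → E → E} {κ Δ d : ℝ} (hκ : 0 ≤ κ) (hd : 0 ≤ d) (hκN : κ * skewGreenBound lam N M < 1)
    (hLip : ∀ (k : ℤ) (v v' : E), ‖v‖ ≤ Δ → ‖v'‖ ≤ Δ →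
      ‖(φ k v - (B k + C k) v) - (φ k v' - (B k + C k) v')‖ ≤ κ * ‖v - v'‖)
    (hφ0 : ∀ k, ‖φ k 0‖ ≤ d) (hdΔ : d ≤ Δ / skewShadowConst lam N M κ) :
    ∃ v : ℤ → E, (∀ k, ‖v k‖ ≤ skewShadowConst lam N M κ * d) ∧ ∀ k, φ k (v k) = v (k + 1) := by
  -- constants
  set N₂ := skewGreenBound lam N M with hN₂
  set L := skewShadowConst lam N M κ with hL
  have hN₂pos : 0 < N₂ := h.skewGreenBound_pos hC.M_nonneg
  have h1κ : 0 < 1 - κ * N₂ := sub_pos.2 hκN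
  have hLpos : 0 < L := div_pos hN₂pos h1κ
  have hLd : L * d ≤ Δ := by rwa [le_div_iff₀ hLpos, mul_comm] at hdΔ
  have hLd0 : 0 ≤ L * d := mul_nonneg hLpos.le hd
  have hΔ : 0 ≤ Δ := hLd0.trans hLd
  have hL1 : L * (1 - κ * N₂) = N₂ := div_mul_cancel₀ _ h1κ.ne'
  have hkey : N₂ * (d + κ * (L * d)) = L * d := by
    calc N₂ * (d + κ * (L * d)) = L * (1 - κ * N₂) * d + κ * N₂ * (L * d) := by rw [hL1]; ring
      _ = L * d := by ring
  -- the nonlinearity read along a bounded sequence (`κ`-Lipschitz on the `Ld`-ball, `Ld ≤ Δ`)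
  have hLip' : ∀ (k : ℤ) (v v' : E), ‖v‖ ≤ L * d → ‖v'‖ ≤ L * d →
      ‖(φ k v - (B k + C k) v) - (φ k v' - (B k + C k) v')‖ ≤ κ * ‖v - v'‖ := fun k v v' hv hv' =>
    hLip k v v' (hv.trans hLd) (hv'.trans hLd)
  let wbar : (ℤ →ᵇ E) → ℤ → E := fun v k => φ (k - 1) (v (k - 1)) - (B (k - 1) + C (k - 1)) (v (k - 1))
  have hw_bound : ∀ v : ℤ →ᵇ E, ‖v‖ ≤ L * d → ∀ k, ‖wbar v k‖ ≤ d + κ * (L * d) := fun v hv k =>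
    norm_nonlin_le (A := fun k => B k + C k) hκ hLip' hφ0 (k - 1) ((v.norm_coe_le_norm (k - 1)).trans hv)
  have hw_lip : ∀ v v' : ℤ →ᵇ E, ‖v‖ ≤ L * d → ‖v'‖ ≤ L * d →
      ∀ k, ‖wbar v k - wbar v' k‖ ≤ κ * ‖v - v'‖ := by
    intro v v' hv hv' k
    refine (hLip' (k - 1) _ _ ((v.norm_coe_le_norm _).trans hv) ((v'.norm_coe_le_norm _).trans hv')).trans ?_
    gcongr
    rw [← BoundedContinuousFunction.sub_apply]
    exact (v - v').norm_coe_le_norm (k - 1)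
  -- the operator `T v = 𝒢 w̄(v)` on the ball `D` of radius `L d`
  let D : Set (ℤ →ᵇ E) := Metric.closedBall 0 (L * d)
  have hD_norm : ∀ v : ℤ →ᵇ E, v ∈ D ↔ ‖v‖ ≤ L * d := fun v => by
    simp only [D, Metric.mem_closedBall, dist_zero_right]
  have hT_bound : ∀ v : ℤ →ᵇ E, ‖v‖ ≤ L * d → ∀ n, ‖skewGreen B P Binv C (wbar v) n‖ ≤ L * d := by
    intro v hv n
    have := h.norm_skewGreen_le hC (hw_bound v hv) n
    rwa [hkey] at this
  let T : (ℤ →ᵇ E) → (ℤ →ᵇ E) := fun v =>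
    if hv : ‖v‖ ≤ L * d then
      BoundedContinuousFunction.ofNormedAddCommGroupDiscrete (skewGreen B P Binv C (wbar v)) (L * d)
        (hT_bound v hv)
    else 0
  have hT_apply : ∀ v : ℤ →ᵇ E, ‖v‖ ≤ L * d → ∀ n, T v n = skewGreen B P Binv C (wbar v) n := by
    intro v hv n
    simp only [T, dif_pos hv, BoundedContinuousFunction.coe_ofNormedAddCommGroupDiscrete]
  have hT_maps : MapsTo T D D := by
    intro v hv
    rw [hD_norm] at hv ⊢
    rw [BoundedContinuousFunction.norm_le hLd0]
    intro n
    rw [hT_apply v hv n]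
    exact hT_bound v hv n
  have hT_lip : ∀ v ∈ D, ∀ v' ∈ D, dist (T v) (T v') ≤ (κ * N₂) * dist v v' := by
    intro v hv v' hv'
    rw [hD_norm] at hv hv'
    rw [dist_eq_norm, dist_eq_norm, BoundedContinuousFunction.norm_le (by positivity)]
    intro n
    rw [BoundedContinuousFunction.sub_apply, hT_apply v hv n, hT_apply v' hv' n,
      ← h.skewGreen_sub hC (hw_bound v hv) (hw_bound v' hv') n]
    calc ‖skewGreen B P Binv C (fun k => wbar v k - wbar v' k) n‖ ≤ N₂ * (κ * ‖v - v'‖) :=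
          h.norm_skewGreen_le hC (hw_lip v v' hv hv') n
      _ = κ * N₂ * ‖v - v'‖ := by ring
  have hDc : IsComplete D := Metric.isClosed_closedBall.isComplete
  have hκN0 : 0 ≤ κ * N₂ := mul_nonneg hκ hN₂pos.le
  have hcontr : ContractingWith (κ * N₂).toNNReal (hT_maps.restrict T D D) := by
    refine ⟨Real.toNNReal_lt_one.2 hκN, LipschitzWith.of_dist_le_mul fun x y => ?_⟩
    rw [Subtype.dist_eq, Subtype.dist_eq, MapsTo.val_restrict_apply, MapsTo.val_restrict_apply,
      Real.coe_toNNReal _ hκN0]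
    exact hT_lip x.1 x.2 y.1 y.2
  have h0D : (0 : ℤ →ᵇ E) ∈ D := by rw [hD_norm, norm_zero]; exact hLd0
  obtain ⟨vstar, hvD, hfix, -⟩ := hcontr.exists_fixedPoint' hDc hT_maps h0D (edist_ne_top _ _)
  have hv_norm : ‖vstar‖ ≤ L * d := (hD_norm vstar).1 hvD
  have hfix' : ∀ n, vstar n = skewGreen B P Binv C (wbar vstar) n := by
    intro n
    have e : T vstar = vstar := hfix
    calc vstar n = T vstar n := by rw [e]
      _ = skewGreen B P Binv C (wbar vstar) n := hT_apply vstar hv_norm n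
  refine ⟨fun k => vstar k, fun k => (vstar.norm_coe_le_norm k).trans hv_norm, fun k => ?_⟩
  have hrec := h.BC_skewGreen hC (hw_bound vstar hv_norm) k
  have hw1 : wbar vstar (k + 1) = φ k (vstar k) - (B k + C k) (vstar k) := by
    simp only [wbar, add_sub_cancel_right]
  rw [← hfix' k, ← hfix' (k + 1), hw1, eq_sub_iff_add_eq] at hrec
  have : (B k + C k) (vstar k) + (φ k (vstar k) - (B k + C k) (vstar k)) = φ k (vstar k) := by abel
  rw [this] at hrec
  exact hrec

end IsHyperbolicSequence

/-! ## Uniqueness under the expansion condition (b') -/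

namespace IsHyperbolicSequence

variable {B P Binv C : ℤ → E →L[ℝ] E} {lam N M : ℝ}

/-- **No bounded homogeneous solutions of the skew recursion.**  Under (a), (b) for `C` and the
expansion condition (b') for `B` (`B_k U_k ⊆ U_{k+1}`, `‖v‖ ≤ λ ‖B_k v‖` on `U_k`), every bounded solution of
`u_{k+1} = (B_k + C_k) u_k`, `k ∈ ℤ`, vanishes: its unstable component solves `t_{k+1} = B_k t_k`, its
stable component then solves `s_{k+1} = B_k s_k + C_k t_k = B_k s_k`. [folklore] -/
theorem eq_zero_of_bounded_skew (h : IsHyperbolicSequence B P Binv lam N) (hC : IsSkewCoupling P C M)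
    (hU : ∀ (k : ℤ), ∀ v ∈ unstableSpace P k, B k v ∈ unstableSpace P (k + 1))
    (hexp : ∀ (k : ℤ), ∀ v ∈ unstableSpace P k, ‖v‖ ≤ lam * ‖B k v‖)
    {u : ℤ → E} {C₀ : ℝ} (hC₀ : ∀ k, ‖u k‖ ≤ C₀) (hrec : ∀ k, u (k + 1) = (B k + C k) (u k)) :
    ∀ k, u k = 0 := by
  set s : ℤ → E := fun k => P k (u k) with hs
  set t : ℤ → E := fun k => ((1 : E →L[ℝ] E) - P k) (u k) with htdef
  have hsmem : ∀ k, s k ∈ stableSpace P k := fun k => apply_mem_stableSpace P k (u k)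
  have htmem : ∀ k, t k ∈ unstableSpace P k := fun k => apply_mem_unstableSpace P k (u k)
  have hsum : ∀ k, s k + t k = u k := fun k => by
    simp only [hs, htdef]
    rw [show ((1 : E →L[ℝ] E) - P k) (u k) = (1 : E →L[ℝ] E) (u k) - P k (u k) from rfl, one_apply_eq_self]
    abel
  have hstep : ∀ k, s (k + 1) = B k (s k) + C k (t k) ∧ t (k + 1) = B k (t k) := by
    intro k
    have hS : B k (s k) + C k (t k) ∈ stableSpace P (k + 1) :=
      Submodule.add_mem _ (h.mapsTo_stable k _ (hsmem k)) (hC.mem_stable k (t k))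
    apply h.decomp_unique (hsmem (k + 1)) hS (htmem (k + 1)) (hU k _ (htmem k))
    rw [hsum, hrec, ← hsum k, map_add, _root_.add_apply, _root_.add_apply,
      hC.apply_stable k _ (hsmem k)]
    abel
  have htb : ∀ k, ‖t k‖ ≤ N * C₀ := fun k =>
    (h.norm_Q_apply_le k (u k)).trans (mul_le_mul_of_nonneg_left (hC₀ k) h.N_nonneg)
  -- the unstable component is a bounded solution of `t_{k+1} = B_k t_k`, hence vanishes
  have ht0 : ∀ k, t k = 0 := h.eq_zero_of_bounded_linear hU hexp htb fun k => (hstep k).2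
  -- hence `u` itself solves `u_{k+1} = B_k u_k` (`C_k u_k = C_k s_k = 0`) and vanishes
  refine h.eq_zero_of_bounded_linear hU hexp hC₀ fun k => ?_
  rw [hrec, _root_.add_apply, ← hsum k, ht0, add_zero, hC.apply_stable k _ (hsmem k), add_zero]

variable [CompleteSpace E]

/-- **Every trajectory in the `Δ`-ball is the fixed point of `𝒢 w̄`** (skew version). [folklore] -/
theorem eq_skewGreen_of_trajectory (h : IsHyperbolicSequence B P Binv lam N) (hC : IsSkewCoupling P C M)
    (hU : ∀ (k : ℤ), ∀ v ∈ unstableSpace P k, B k v ∈ unstableSpace P (k + 1))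
    (hexp : ∀ (k : ℤ), ∀ v ∈ unstableSpace P k, ‖v‖ ≤ lam * ‖B k v‖)
    {φ : ℤ → E → E} {κ Δ d : ℝ} (hκ : 0 ≤ κ)
    (hLip : ∀ (k : ℤ) (v v' : E), ‖v‖ ≤ Δ → ‖v'‖ ≤ Δ →
      ‖(φ k v - (B k + C k) v) - (φ k v' - (B k + C k) v')‖ ≤ κ * ‖v - v'‖)
    (hφ0 : ∀ k, ‖φ k 0‖ ≤ d) {v : ℤ → E} (hv : ∀ k, ‖v k‖ ≤ Δ) (htraj : ∀ k, φ k (v k) = v (k + 1)) :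
    ∀ n, v n = skewGreen B P Binv C (fun k => φ (k - 1) (v (k - 1)) - (B (k - 1) + C (k - 1)) (v (k - 1))) n := by
  set g : ℤ → E := fun k => φ (k - 1) (v (k - 1)) - (B (k - 1) + C (k - 1)) (v (k - 1)) with hg
  have hgb : ∀ k, ‖g k‖ ≤ d + κ * Δ := fun k =>
    norm_nonlin_le (A := fun k => B k + C k) hκ hLip hφ0 (k - 1) (hv _)
  have hGb : ∀ k, ‖skewGreen B P Binv C g k‖ ≤ skewGreenBound lam N M * (d + κ * Δ) := fun k =>
    h.norm_skewGreen_le hC hgb k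
  have hub : ∀ k, ‖v k - skewGreen B P Binv C g k‖ ≤ Δ + skewGreenBound lam N M * (d + κ * Δ) := fun k =>
    (norm_sub_le _ _).trans (add_le_add (hv k) (hGb k))
  have hurec : ∀ k, v (k + 1) - skewGreen B P Binv C g (k + 1) = (B k + C k) (v k - skewGreen B P Binv C g k) := by
    intro k
    rw [map_sub, h.BC_skewGreen hC hgb k]
    have : g (k + 1) = φ k (v k) - (B k + C k) (v k) := by simp only [hg, add_sub_cancel_right]
    rw [this, ← htraj k]
    abel
  have hu0 := h.eq_zero_of_bounded_skew hC hU hexp hub hurec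
  intro n
  exact sub_eq_zero.1 (hu0 n)

/-- **Uniqueness of trajectories in the `Δ`-ball** for skew linear parts (the uniqueness companion of
Pilyugin's Theorem 1.3.5, under (a), (b), (b') and `κ N₂ < 1`): two trajectories of `φ` all of whose terms
have norm `≤ Δ` coincide. [cite: Pilyugin1999, Thm 1.3.5 (uniqueness variant, cf. Thm 1.3.2)] -/
theorem shadow_unique_skew (h : IsHyperbolicSequence B P Binv lam N) (hC : IsSkewCoupling P C M)
    (hU : ∀ (k : ℤ), ∀ v ∈ unstableSpace P k, B k v ∈ unstableSpace P (k + 1))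
    (hexp : ∀ (k : ℤ), ∀ v ∈ unstableSpace P k, ‖v‖ ≤ lam * ‖B k v‖)
    {φ : ℤ → E → E} {κ Δ d : ℝ} (hκ : 0 ≤ κ) (hκN : κ * skewGreenBound lam N M < 1)
    (hLip : ∀ (k : ℤ) (v v' : E), ‖v‖ ≤ Δ → ‖v'‖ ≤ Δ →
      ‖(φ k v - (B k + C k) v) - (φ k v' - (B k + C k) v')‖ ≤ κ * ‖v - v'‖)
    (hφ0 : ∀ k, ‖φ k 0‖ ≤ d) {v v' : ℤ → E} (hv : ∀ k, ‖v k‖ ≤ Δ) (hv' : ∀ k, ‖v' k‖ ≤ Δ)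
    (htraj : ∀ k, φ k (v k) = v (k + 1)) (htraj' : ∀ k, φ k (v' k) = v' (k + 1)) : v = v' := by
  have hΔ : 0 ≤ Δ := (norm_nonneg _).trans (hv 0)
  have hvG := h.eq_skewGreen_of_trajectory hC hU hexp hκ hLip hφ0 hv htraj
  have hvG' := h.eq_skewGreen_of_trajectory hC hU hexp hκ hLip hφ0 hv' htraj'
  set g : ℤ → E := fun k => φ (k - 1) (v (k - 1)) - (B (k - 1) + C (k - 1)) (v (k - 1)) with hg
  set g' : ℤ → E := fun k => φ (k - 1) (v' (k - 1)) - (B (k - 1) + C (k - 1)) (v' (k - 1)) with hg'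
  have hgb : ∀ k, ‖g k‖ ≤ d + κ * Δ := fun k =>
    norm_nonlin_le (A := fun k => B k + C k) hκ hLip hφ0 (k - 1) (hv _)
  have hgb' : ∀ k, ‖g' k‖ ≤ d + κ * Δ := fun k =>
    norm_nonlin_le (A := fun k => B k + C k) hκ hLip hφ0 (k - 1) (hv' _)
  have hdiff : ∀ M' : ℝ, (∀ k, ‖v k - v' k‖ ≤ M') → ∀ k, ‖v k - v' k‖ ≤ κ * skewGreenBound lam N M * M' := by
    intro M' hM k
    have hgd : ∀ j, ‖g j - g' j‖ ≤ κ * M' := fun j =>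
      (hLip (j - 1) _ _ (hv _) (hv' _)).trans (mul_le_mul_of_nonneg_left (hM _) hκ)
    rw [hvG k, hvG' k, ← h.skewGreen_sub hC hgb hgb' k]
    calc ‖skewGreen B P Binv C (fun j => g j - g' j) k‖ ≤ skewGreenBound lam N M * (κ * M') :=
          h.norm_skewGreen_le hC hgd k
      _ = κ * skewGreenBound lam N M * M' := by ring
  have hit : ∀ (j : ℕ) (k : ℤ), ‖v k - v' k‖ ≤ (κ * skewGreenBound lam N M) ^ j * (2 * Δ) := by
    intro j
    induction j with
    | zero =>
      intro k
      have := (norm_sub_le (v k) (v' k)).trans (add_le_add (hv k) (hv' k))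
      simpa [two_mul] using this
    | succ j ih =>
      intro k
      calc ‖v k - v' k‖ ≤ κ * skewGreenBound lam N M * ((κ * skewGreenBound lam N M) ^ j * (2 * Δ)) :=
            hdiff _ ih k
        _ = (κ * skewGreenBound lam N M) ^ (j + 1) * (2 * Δ) := by ring
  funext k
  exact sub_eq_zero.1 (eq_zero_of_norm_le_geom (mul_nonneg hκ (h.skewGreenBound_pos hC.M_nonneg).le) hκN
    fun j => hit j k)

end IsHyperbolicSequence

end Literature.Dynamics.Hyperbolic

end
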